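import Mathlib
import HarnessLib
import Summits.ValiantsHypothesis.ValiantsHypothesis.Theorems.ValuativeGCTTailFlipTopBoundaryFlipConstraints
import Summits.ValiantsHypothesis.ValiantsHypothesis.Theorems.ValuativeGCTValuativeFlipOfKroneckerFlip
import Summits.ValiantsHypothesis.ValiantsHypothesis.Theorems.ValuativeGCTValuativeFlipTailSuffices
import Summits.ValiantsHypothesis.ValiantsHypothesis.Theorems.ValuativeGCTValuativeFlipInnerMonotone
import Summits.ValiantsHypothesis.ValiantsHypothesis.Theorems.ValuativeGCTValuativeFlipRayStabilityKronecker
import Summits.ValiantsHypothesis.ValiantsHypothesis.Theorems.TailFlip.Negative.TailFlipKillTransfer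

/-!
# `ValuativeGCT.TailFlip` (stmt-ValiantsHypothesis-15687), line `boundary-ray-collapse`:
# strength and normal form of the residual stub `stub_topBoundaryFlip`

Helper file `--supports stmt-ValiantsHypothesis-15687` (continuation lead c2 of the line).  The residual
(registered stub `stub_topBoundaryFlip`, skeleton `Cruxes/TailFlip/Lines/boundary_ray_collapse.lean`) is

  `S : ∃ k ≥ 2, ∀ c, ∃ n₀, ∀ n ≥ n₀, n^k ≤ M → ∃ m₀ [NeZero m₀] δ (λ ⊢ m₀δ), n < m₀ ≤ n^k ∧ ℓ(λ) ≤ n²+1 ∧`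
  `      λ₁ = δ(m₀ - n) ∧ g(λ♯M, M×δ, M×δ) < P_{n,m₀}(λ)`,   `M = M_c(n) = 2^((log₂ n + c)^c)`,

where `P_{n,m}(λ) = mult_{λ*} ℂ[Δ_m(X₀₀^{m-n} per_n)]` and `g` is the rectangular Kronecker coefficient.  It
is open (a multiplicity obstruction against the Kronecker majorant).  This file records, sorry-free and
without deciding `S`, exactly how strong it is and its simplest equivalent form:

* `kroneckerFlip_on_ray_of_top` — ONE top inequality flips the WHOLE ray against the Kronecker
  coefficient: if `g(λ♯(m₀+J)) < P_{n,m₀}(λ)` for a boundary shape `λ` of `(n, m₀)`, then for every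
  `j ≤ J`, `g(λ♯(m₀+j), (m₀+j)×δ, (m₀+j)×δ) < P_{n,m₀+j}(λ♯(m₀+j))` (Kronecker ray monotonicity
  `kronecker_ray_mono` below, the lever `boundaryPaddingInvariance` above).
* `gctKroneckerFlip_iff_polyPadded` — re-windowing for Kronecker flips: route GCTMult's crux
  `GctKroneckerFlip` (stmt-ValiantsHypothesis-0888) is equivalent to its restriction to the polynomially
  padded positions `n^k ≤ m`, for every `k ≥ 1` (inner monotonicity `orbitMultiplicity_paddedPer_mono_inner`;
  the Kronecker side does not see `n`) — the Kronecker analogue of `valuativeFlip_iff_polyPadded`.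
* `gctKroneckerFlip_of_topBoundaryFlip` — **`S ⇒ GCTMult.GctKroneckerFlip`** (stmt-0888, open crux of a
  second route), hence (`valuativeFlip_of_gctKroneckerFlip`, `tailFlip_iff_valuativeFlip`)
  `S ⇒ ValuativeFlip`, `S ⇒ TailFlip` (`tailFlip_of_topBoundaryFlip`, the skeleton's composition as a
  closed implication) and `S ⇒ DcPerSuperpolynomial ℂ` (`dcPerSuperpolynomial_of_topBoundaryFlip`).
  So the residual sits ABOVE two open cruxes: it is crux-sized, not a lemma.
* `topBoundaryFlip_mono_exponent` — `S` with exponent `k` implies `S` with any `k' ≥ k`.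
* `topBoundaryFlip_iff_topBase` — **normal form**: the free base `n < m₀ ≤ n^k` buys nothing — `S` is
  equivalent to the statement with the base PINNED at `m₀ = n^k` (lift the datum along the boundary ray
  by the lever; the Kronecker side at the top is unchanged, `parts_rowLift_rowLift`):
  `S ⇔ ∃ k ≥ 2, ∀ c, ∃ n₀, ∀ n ≥ n₀, n^k ≤ M → ∃ δ (λ ⊢ n^k·δ), ℓ(λ) ≤ n²+1 ∧ λ₁ = δ(n^k - n) ∧`
  `g(λ♯M, M×δ, M×δ) < P_{n,n^k}(λ)`.

Sources: BLMW, SIAM J. Comput. 40 (2011) Prop. 5.2.1; L. Manivel, arXiv:0907.3351 Thm 1 (monotonicity);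
Bürgisser–Ikenmeyer–Panova, J. AMS 32 (2019) §1(a) (inner monotonicity); this line's landed files
(`…TailFlipBoundaryPaddingInvariance`, `…TailFlipTopBoundaryFlipConstraints`), the route's
`…ValuativeFlipOfKroneckerFlip`, `…ValuativeFlipTailSuffices`, `TailFlip/Negative/TailFlipKillTransfer`.
-/

set_option linter.dupNamespace false

namespace Summit.ValiantsHypothesis.ValiantsHypothesis.Theorems.TailFlip

open MvPolynomial
open scoped BigOperators Matrix
open Literature.NumberTheory.DiophantineGeometry
open Literature.Computability.AlgebraicComplexity
open Literature.Computability.Complexity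
open Summit.ValiantsHypothesis.ValiantsHypothesis.Theses.ValuativeGCT
open Summit.ValiantsHypothesis.ValiantsHypothesis.Theorems.ValuativeFlip
open Summit.ValiantsHypothesis.Theorems.DetqpThesis.Negative (qpBound_mono)

noncomputable section

/-! ## §1 One top inequality flips the whole ray against the Kronecker coefficient -/

/-- **A top inequality flips the whole boundary ray (Kronecker currency).**  For `n < m₀`, a boundary
shape `λ ⊢ m₀δ` of `(n, m₀)` (at most `n² + 1` parts, `λ₁ = δ(m₀ - n)`) and a top padding `J` with
`g(λ♯(m₀+J), (m₀+J)×δ, (m₀+J)×δ) < P_{n,m₀}(λ)`: at EVERY level `m₀ + j`, `j ≤ J`,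
`g(λ♯(m₀+j), (m₀+j)×δ, (m₀+j)×δ) < P_{n,m₀+j}(λ♯(m₀+j))` — below by Kronecker ray monotonicity
(`kronecker_ray_mono`, Manivel), above by the lever of the line (`boundaryPaddingInvariance`).
[Manivel 2011 Thm 1; this line] -/
theorem kroneckerFlip_on_ray_of_top {n m₀ δ J : ℕ} [NeZero m₀] (hnm : n < m₀)
    (lam : Nat.Partition (m₀ * δ)) (hcard : lam.parts.card ≤ n * n + 1)
    (hsup : lam.parts.sup = δ * (m₀ - n))
    (htop : kroneckerCoeff ℂ (rowLift lam J) (Nat.Partition.rectangle (m₀ + J) δ)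
        (Nat.Partition.rectangle (m₀ + J) δ) <
      orbitMultiplicity ℂ (paddedPerFormLex ℂ n m₀) m₀ (partitionWeightLex m₀ lam))
    {j : ℕ} (hj : j ≤ J) [NeZero (m₀ + j)] :
    kroneckerCoeff ℂ (rowLift lam j) (Nat.Partition.rectangle (m₀ + j) δ)
        (Nat.Partition.rectangle (m₀ + j) δ) <
      orbitMultiplicity ℂ (paddedPerFormLex ℂ n (m₀ + j)) (m₀ + j)
        (partitionWeightLex (m₀ + j) (rowLift lam j)) := by
  have hlam : lam.parts.card ≤ m₀ * m₀ := card_parts_le_sq_of_lt hnm lam hcard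
  calc kroneckerCoeff ℂ (rowLift lam j) (Nat.Partition.rectangle (m₀ + j) δ)
        (Nat.Partition.rectangle (m₀ + j) δ)
      ≤ kroneckerCoeff ℂ (rowLift lam J) (Nat.Partition.rectangle (m₀ + J) δ)
          (Nat.Partition.rectangle (m₀ + J) δ) := kronecker_ray_mono m₀ δ lam hj
    _ < orbitMultiplicity ℂ (paddedPerFormLex ℂ n m₀) m₀ (partitionWeightLex m₀ lam) := htop
    _ ≤ orbitMultiplicity ℂ (paddedPerFormLex ℂ n (m₀ + j)) (m₀ + j)
          (partitionWeightLex (m₀ + j) (rowLift lam j)) :=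
        boundaryPaddingInvariance n m₀ j δ hnm lam hlam hsup

/-! ## §2 Re-windowing for Kronecker flips -/

/-- **`GctKroneckerFlip` is equivalent to its restriction to the positions `n^k ≤ m`** of the window,
for every fixed `k ≥ 1` (the Kronecker analogue of `valuativeFlip_iff_polyPadded`).  Forward: `n ≤ n^k`.
Backward: given `c`, use the restricted statement with exponent `c + k + 1`; a position `(n, m)` with
`m < n^k` is reached from the steep position `(n'', m)`, `n'' = max {t ≤ m : t^k ≤ m}`, which has
`n''^k ≤ m < (n''+1)^k ≤ 2^((log₂ n'' + c + k + 1)^(c+k+1))` (`succ_pow_le_window`) and `n'' ≤ n`, by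
inner monotonicity of the padded-permanent multiplicity (`orbitMultiplicity_paddedPer_mono_inner`; the
Kronecker coefficient does not depend on `n`). [BIP 2019 §1(a); this route (`…TailSuffices`)] -/
theorem gctKroneckerFlip_iff_polyPadded (k : ℕ) (hk : 1 ≤ k) :
    Summit.ValiantsHypothesis.ValiantsHypothesis.Theses.GCTMult.GctKroneckerFlip ↔
      ∀ c : ℕ, ∃ n₀ : ℕ, ∀ n ≥ n₀, ∀ (m : ℕ) [NeZero m], n ^ k ≤ m → m ≤ 2 ^ ((Nat.log 2 n + c) ^ c) →
        ∃ (d : ℕ) (lam : Nat.Partition (m * d)), lam.parts.card ≤ m * m ∧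
          kroneckerCoeff ℂ lam (Nat.Partition.rectangle m d) (Nat.Partition.rectangle m d) <
            orbitMultiplicity ℂ (paddedPerFormLex ℂ n m) m (partitionWeightLex m lam) := by
  constructor
  · intro hK c
    obtain ⟨n₀, hn₀⟩ := hK c
    refine ⟨n₀, fun n hn m _ hnk hm => hn₀ n hn m ?_ hm⟩
    rcases Nat.eq_zero_or_pos n with h0 | hpos
    · omega
    · exact le_trans (by simpa using Nat.pow_le_pow_right hpos hk) hnk
  · intro H c
    obtain ⟨n₁, hn₁⟩ := H (c + k + 1)
    refine ⟨(n₁ + 1) ^ k + 1, fun n hn m _ hnm hm => ?_⟩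
    have hk0 : k ≠ 0 := by omega
    have hn₁le : n₁ + 1 ≤ (n₁ + 1) ^ k := le_self_pow (by omega) hk0
    by_cases hcase : n ^ k ≤ m
    · exact hn₁ n (by omega) m hcase (hm.trans (qpBound_mono (by omega) n))
    · rw [not_le] at hcase
      -- the steep inner size `n'' = max {t ≤ m : t ^ k ≤ m}`
      set n'' := Nat.findGreatest (fun t => t ^ k ≤ m) m with hn''
      have hP0 : (0 : ℕ) ^ k ≤ m := by rw [zero_pow hk0]; exact Nat.zero_le m
      have hspec : n'' ^ k ≤ m := Nat.findGreatest_spec (P := fun t => t ^ k ≤ m) (Nat.zero_le m) hP0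
      have hle_m : n'' ≤ m := Nat.findGreatest_le m
      have hsucc : m < (n'' + 1) ^ k := by
        rcases eq_or_lt_of_le hle_m with heq | hlt
        · calc m < m + 1 := Nat.lt_succ_self m
            _ ≤ (m + 1) ^ k := le_self_pow (by omega) hk0
            _ = (n'' + 1) ^ k := by rw [heq]
        · by_contra hge
          rw [not_lt] at hge
          exact Nat.findGreatest_is_greatest (P := fun t => t ^ k ≤ m) (Nat.lt_succ_self n'') (by omega) hge
      -- `n'' ≤ n` since `n''^k ≤ m < n^k`
      have hn''n : n'' ≤ n := by
        have : n'' ^ k < n ^ k := lt_of_le_of_lt hspec hcase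
        exact ((Nat.pow_lt_pow_iff_left hk0).mp this).le
      -- `n₁ ≤ n''` since `(n₁+1)^k ≤ n ≤ m < (n''+1)^k`
      have hn₁n'' : n₁ ≤ n'' := by
        have : (n₁ + 1) ^ k < (n'' + 1) ^ k := by omega
        have := (Nat.pow_lt_pow_iff_left hk0).mp this
        omega
      have hwin : m ≤ 2 ^ ((Nat.log 2 n'' + (c + k + 1)) ^ (c + k + 1)) :=
        hsucc.le.trans (succ_pow_le_window k c n'')
      obtain ⟨d, lam, hcard, hlt⟩ := hn₁ n'' hn₁n'' m hspec hwin
      exact ⟨d, lam, hcard, lt_of_lt_of_le hlt (orbitMultiplicity_paddedPer_mono_inner hn''n hnm _)⟩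

/-! ## §3 Strength: the residual implies `GctKroneckerFlip`, `ValuativeFlip`, `TailFlip`, `DcPerSuperpolynomial` -/

/-- **`stub_topBoundaryFlip ⇒ GCTMult.GctKroneckerFlip`** (stmt-ValiantsHypothesis-0888).  By
`gctKroneckerFlip_iff_polyPadded k` only positions `n^k ≤ m ≤ M_c(n)` matter; such a position is
`m = m₀ + j` on the boundary ray above the base of the datum supplied by the residual at `(n, c)`, and
`kroneckerFlip_on_ray_of_top` flips it with the shape `λ♯(m₀+j)` (at most `(m₀+j)²` parts).
[this line] -/
theorem gctKroneckerFlip_of_topBoundaryFlip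
    (hS : ∃ k : ℕ, 2 ≤ k ∧ ∀ c : ℕ, ∃ n₀ : ℕ, ∀ n ≥ n₀,
      n ^ k ≤ 2 ^ ((Nat.log 2 n + c) ^ c) →
      ∃ (m₀ : ℕ) (_ : NeZero m₀) (δ : ℕ) (lam : Nat.Partition (m₀ * δ)),
        n < m₀ ∧ m₀ ≤ n ^ k ∧ lam.parts.card ≤ n * n + 1 ∧ lam.parts.sup = δ * (m₀ - n) ∧
        kroneckerCoeff ℂ (rowLift lam (2 ^ ((Nat.log 2 n + c) ^ c) - m₀))
            (Nat.Partition.rectangle (m₀ + (2 ^ ((Nat.log 2 n + c) ^ c) - m₀)) δ)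
            (Nat.Partition.rectangle (m₀ + (2 ^ ((Nat.log 2 n + c) ^ c) - m₀)) δ) <
          orbitMultiplicity ℂ (paddedPerFormLex ℂ n m₀) m₀ (partitionWeightLex m₀ lam)) :
    Summit.ValiantsHypothesis.ValiantsHypothesis.Theses.GCTMult.GctKroneckerFlip := by
  obtain ⟨k, hk, hC⟩ := hS
  refine (gctKroneckerFlip_iff_polyPadded k (by omega)).mpr fun c => ?_
  obtain ⟨n₀, hn₀⟩ := hC c
  refine ⟨n₀, fun n hn m _ hkm hm => ?_⟩
  obtain ⟨m₀, hm₀, δ, lam, hnm₀, hm₀k, hcard, hsup, hlt⟩ := hn₀ n hn (hkm.trans hm)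
  haveI := hm₀
  -- the position lies on the ray above the base: `m = m₀ + j`
  obtain ⟨j, rfl⟩ : ∃ j, m = m₀ + j := ⟨m - m₀, by omega⟩
  have hjM : j ≤ 2 ^ ((Nat.log 2 n + c) ^ c) - m₀ := by omega
  exact ⟨δ, rowLift lam j, card_parts_rowLift_le_sq lam (card_parts_le_sq_of_lt hnm₀ lam hcard) j,
    kroneckerFlip_on_ray_of_top hnm₀ lam hcard hsup hlt hjM⟩

/-- **`stub_topBoundaryFlip ⇒ ValuativeGCT.ValuativeFlip`** (stmt-ValiantsHypothesis-12624), through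
`GctKroneckerFlip` and the no-cut centre (`valuativeFlip_of_gctKroneckerFlip`). [this line] -/
theorem valuativeFlip_of_topBoundaryFlip
    (hS : ∃ k : ℕ, 2 ≤ k ∧ ∀ c : ℕ, ∃ n₀ : ℕ, ∀ n ≥ n₀,
      n ^ k ≤ 2 ^ ((Nat.log 2 n + c) ^ c) →
      ∃ (m₀ : ℕ) (_ : NeZero m₀) (δ : ℕ) (lam : Nat.Partition (m₀ * δ)),
        n < m₀ ∧ m₀ ≤ n ^ k ∧ lam.parts.card ≤ n * n + 1 ∧ lam.parts.sup = δ * (m₀ - n) ∧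
        kroneckerCoeff ℂ (rowLift lam (2 ^ ((Nat.log 2 n + c) ^ c) - m₀))
            (Nat.Partition.rectangle (m₀ + (2 ^ ((Nat.log 2 n + c) ^ c) - m₀)) δ)
            (Nat.Partition.rectangle (m₀ + (2 ^ ((Nat.log 2 n + c) ^ c) - m₀)) δ) <
          orbitMultiplicity ℂ (paddedPerFormLex ℂ n m₀) m₀ (partitionWeightLex m₀ lam)) :
    ValuativeFlip :=
  valuativeFlip_of_gctKroneckerFlip (gctKroneckerFlip_of_topBoundaryFlip hS)

/-- **`stub_topBoundaryFlip ⇒ ValuativeGCT.TailFlip`** (stmt-ValiantsHypothesis-15687): the composition of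
the skeleton `Cruxes/TailFlip/Lines/boundary_ray_collapse.lean` (`TailFlip_of`) as a closed implication
(`tailFlip_iff_valuativeFlip`). [this line] -/
theorem tailFlip_of_topBoundaryFlip
    (hS : ∃ k : ℕ, 2 ≤ k ∧ ∀ c : ℕ, ∃ n₀ : ℕ, ∀ n ≥ n₀,
      n ^ k ≤ 2 ^ ((Nat.log 2 n + c) ^ c) →
      ∃ (m₀ : ℕ) (_ : NeZero m₀) (δ : ℕ) (lam : Nat.Partition (m₀ * δ)),
        n < m₀ ∧ m₀ ≤ n ^ k ∧ lam.parts.card ≤ n * n + 1 ∧ lam.parts.sup = δ * (m₀ - n) ∧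
        kroneckerCoeff ℂ (rowLift lam (2 ^ ((Nat.log 2 n + c) ^ c) - m₀))
            (Nat.Partition.rectangle (m₀ + (2 ^ ((Nat.log 2 n + c) ^ c) - m₀)) δ)
            (Nat.Partition.rectangle (m₀ + (2 ^ ((Nat.log 2 n + c) ^ c) - m₀)) δ) <
          orbitMultiplicity ℂ (paddedPerFormLex ℂ n m₀) m₀ (partitionWeightLex m₀ lam)) :
    TailFlip :=
  tailFlip_iff_valuativeFlip.mpr (valuativeFlip_of_topBoundaryFlip hS)

/-- **`stub_topBoundaryFlip ⇒ DcPerSuperpolynomial ℂ`**: the residual proves Valiant's hypothesis in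
determinantal-complexity form (`Negative.dcPerSuperpolynomial_of_tailFlip`). [this route] -/
theorem dcPerSuperpolynomial_of_topBoundaryFlip
    (hS : ∃ k : ℕ, 2 ≤ k ∧ ∀ c : ℕ, ∃ n₀ : ℕ, ∀ n ≥ n₀,
      n ^ k ≤ 2 ^ ((Nat.log 2 n + c) ^ c) →
      ∃ (m₀ : ℕ) (_ : NeZero m₀) (δ : ℕ) (lam : Nat.Partition (m₀ * δ)),
        n < m₀ ∧ m₀ ≤ n ^ k ∧ lam.parts.card ≤ n * n + 1 ∧ lam.parts.sup = δ * (m₀ - n) ∧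
        kroneckerCoeff ℂ (rowLift lam (2 ^ ((Nat.log 2 n + c) ^ c) - m₀))
            (Nat.Partition.rectangle (m₀ + (2 ^ ((Nat.log 2 n + c) ^ c) - m₀)) δ)
            (Nat.Partition.rectangle (m₀ + (2 ^ ((Nat.log 2 n + c) ^ c) - m₀)) δ) <
          orbitMultiplicity ℂ (paddedPerFormLex ℂ n m₀) m₀ (partitionWeightLex m₀ lam)) :
    DcPerSuperpolynomial ℂ :=
  Negative.dcPerSuperpolynomial_of_tailFlip (tailFlip_of_topBoundaryFlip hS)

/-! ## §4 Monotonicity in the exponent `k` -/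

/-- **The residual is monotone in its exponent**: the statement with `k` implies the statement with any
`k' ≥ k` (a window reaching `n^{k'}` reaches `n^k` once `n ≥ 1`, and a base `m₀ ≤ n^k` is `≤ n^{k'}`).
[this line] -/
theorem topBoundaryFlip_mono_exponent {k k' : ℕ} (hkk' : k ≤ k')
    (hS : ∀ c : ℕ, ∃ n₀ : ℕ, ∀ n ≥ n₀,
      n ^ k ≤ 2 ^ ((Nat.log 2 n + c) ^ c) →
      ∃ (m₀ : ℕ) (_ : NeZero m₀) (δ : ℕ) (lam : Nat.Partition (m₀ * δ)),
        n < m₀ ∧ m₀ ≤ n ^ k ∧ lam.parts.card ≤ n * n + 1 ∧ lam.parts.sup = δ * (m₀ - n) ∧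
        kroneckerCoeff ℂ (rowLift lam (2 ^ ((Nat.log 2 n + c) ^ c) - m₀))
            (Nat.Partition.rectangle (m₀ + (2 ^ ((Nat.log 2 n + c) ^ c) - m₀)) δ)
            (Nat.Partition.rectangle (m₀ + (2 ^ ((Nat.log 2 n + c) ^ c) - m₀)) δ) <
          orbitMultiplicity ℂ (paddedPerFormLex ℂ n m₀) m₀ (partitionWeightLex m₀ lam)) :
    ∀ c : ℕ, ∃ n₀ : ℕ, ∀ n ≥ n₀,
      n ^ k' ≤ 2 ^ ((Nat.log 2 n + c) ^ c) →
      ∃ (m₀ : ℕ) (_ : NeZero m₀) (δ : ℕ) (lam : Nat.Partition (m₀ * δ)),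
        n < m₀ ∧ m₀ ≤ n ^ k' ∧ lam.parts.card ≤ n * n + 1 ∧ lam.parts.sup = δ * (m₀ - n) ∧
        kroneckerCoeff ℂ (rowLift lam (2 ^ ((Nat.log 2 n + c) ^ c) - m₀))
            (Nat.Partition.rectangle (m₀ + (2 ^ ((Nat.log 2 n + c) ^ c) - m₀)) δ)
            (Nat.Partition.rectangle (m₀ + (2 ^ ((Nat.log 2 n + c) ^ c) - m₀)) δ) <
          orbitMultiplicity ℂ (paddedPerFormLex ℂ n m₀) m₀ (partitionWeightLex m₀ lam) := by
  intro c
  obtain ⟨n₀, hn₀⟩ := hS c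
  refine ⟨n₀ + 1, fun n hn hguard => ?_⟩
  have hkk : n ^ k ≤ n ^ k' := Nat.pow_le_pow_right (by omega) hkk'
  obtain ⟨m₀, hm₀, δ, lam, hnm₀, hm₀k, hcard, hsup, hlt⟩ := hn₀ n (by omega) (hkk.trans hguard)
  exact ⟨m₀, hm₀, δ, lam, hnm₀, hm₀k.trans hkk, hcard, hsup, hlt⟩

/-! ## §5 Normal form: the base may be pinned at `m₀ = n^k` -/

/-- **Lifting a top-flip datum to a higher base.**  If a boundary shape `λ` of `(n, m₀)` flips the top
level `T ≥ m₀ + i` against the Kronecker coefficient from the base `m₀`, then its row-lift `λ♯(m₀+i)` — a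
boundary shape of `(n, m₀ + i)` — does so from the base `m₀ + i`: the Kronecker side at the top is the
same partition (`parts_rowLift_rowLift`), and the per side only grows (`boundaryPaddingInvariance`).
[this line] -/
theorem topBoundaryDatum_lift_base {n m₀ δ T : ℕ} [NeZero m₀] (hnm : n < m₀) (i : ℕ) [NeZero (m₀ + i)]
    (hT : m₀ + i ≤ T) (lam : Nat.Partition (m₀ * δ)) (hcard : lam.parts.card ≤ n * n + 1)
    (hsup : lam.parts.sup = δ * (m₀ - n))
    (htop : kroneckerCoeff ℂ (rowLift lam (T - m₀)) (Nat.Partition.rectangle (m₀ + (T - m₀)) δ)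
        (Nat.Partition.rectangle (m₀ + (T - m₀)) δ) <
      orbitMultiplicity ℂ (paddedPerFormLex ℂ n m₀) m₀ (partitionWeightLex m₀ lam)) :
    (rowLift lam i).parts.card ≤ n * n + 1 ∧ (rowLift lam i).parts.sup = δ * (m₀ + i - n) ∧
      kroneckerCoeff ℂ (rowLift (rowLift lam i) (T - (m₀ + i)))
          (Nat.Partition.rectangle (m₀ + i + (T - (m₀ + i))) δ)
          (Nat.Partition.rectangle (m₀ + i + (T - (m₀ + i))) δ) <
        orbitMultiplicity ℂ (paddedPerFormLex ℂ n (m₀ + i)) (m₀ + i)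
          (partitionWeightLex (m₀ + i) (rowLift lam i)) := by
  have hlam : lam.parts.card ≤ m₀ * m₀ := card_parts_le_sq_of_lt hnm lam hcard
  refine ⟨(card_parts_rowLift_le lam i).trans (max_le hcard (by omega)),
    sup_parts_rowLift_of_boundary hnm lam hsup i, ?_⟩
  -- the Kronecker side at the top is the same partition
  have hparts : (rowLift (rowLift lam i) (T - (m₀ + i))).parts = (rowLift lam (T - m₀)).parts := by
    rw [parts_rowLift_rowLift]
    exact congrArg (fun t => (rowLift lam t).parts) (by omega)
  rw [kroneckerCoeff_rectangle_congr_level (m₂ := m₀ + (T - m₀)) (by omega)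
    (rowLift (rowLift lam i) (T - (m₀ + i))) (rowLift lam (T - m₀)) hparts]
  exact lt_of_lt_of_le htop (boundaryPaddingInvariance n m₀ i δ hnm lam hlam hsup)

/-- Transport of a pinned-base top-flip datum along an equality of base levels. [folklore] -/
theorem topBoundaryDatum_congr_level {n m₁ m₂ T : ℕ} (h : m₁ = m₂) [NeZero m₁] [NeZero m₂]
    (hex : ∃ (δ : ℕ) (lam : Nat.Partition (m₁ * δ)), lam.parts.card ≤ n * n + 1 ∧
        lam.parts.sup = δ * (m₁ - n) ∧
        kroneckerCoeff ℂ (rowLift lam (T - m₁)) (Nat.Partition.rectangle (m₁ + (T - m₁)) δ)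
            (Nat.Partition.rectangle (m₁ + (T - m₁)) δ) <
          orbitMultiplicity ℂ (paddedPerFormLex ℂ n m₁) m₁ (partitionWeightLex m₁ lam)) :
    ∃ (δ : ℕ) (lam : Nat.Partition (m₂ * δ)), lam.parts.card ≤ n * n + 1 ∧
        lam.parts.sup = δ * (m₂ - n) ∧
        kroneckerCoeff ℂ (rowLift lam (T - m₂)) (Nat.Partition.rectangle (m₂ + (T - m₂)) δ)
            (Nat.Partition.rectangle (m₂ + (T - m₂)) δ) <
          orbitMultiplicity ℂ (paddedPerFormLex ℂ n m₂) m₂ (partitionWeightLex m₂ lam) := by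
  subst h
  exact hex

/-- **Normal form of the residual: the base may be pinned at `m₀ = n^k`.**  `stub_topBoundaryFlip` (free
base `n < m₀ ≤ n^k`) is EQUIVALENT to the statement with the single base `m₀ = n^k`: forward, lift the
datum along the boundary ray to `n^k` (`topBoundaryDatum_lift_base`: the Kronecker side at the top is
unchanged, the per side only grows by the lever); backward, `n^k` is an admissible base as soon as `n ≥ 2`.
So the freedom of the base, introduced by the planner to weaken the card's `m₀ = 2n`, provably adds
nothing beyond choosing the HIGHEST polynomial base. [this line] -/
theorem topBoundaryFlip_iff_topBase : (∃ k : ℕ, 2 ≤ k ∧ ∀ c : ℕ, ∃ n₀ : ℕ, ∀ n ≥ n₀, n ^ k ≤ 2 ^ ((Nat.log 2 n + c) ^ c) → ∃ (m₀ : ℕ) (_ : NeZero m₀) (δ : ℕ) (lam : Nat.Partition (m₀ * δ)), n < m₀ ∧ m₀ ≤ n ^ k ∧ lam.parts.card ≤ n * n + 1 ∧ lam.parts.sup = δ * (m₀ - n) ∧ kroneckerCoeff ℂ (rowLift lam (2 ^ ((Nat.log 2 n + c) ^ c) - m₀)) (Nat.Partition.rectangle (m₀ + (2 ^ ((Nat.log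 2 n + c) ^ c) - m₀)) δ) (Nat.Partition.rectangle (m₀ + (2 ^ ((Nat.log 2 n + c) ^ c) - m₀)) δ) < orbitMultiplicity ℂ (paddedPerFormLex ℂ n m₀) m₀ (partitionWeightLex m₀ lam)) ↔ (∃ k : ℕ, 2 ≤ k ∧ ∀ c : ℕ, ∃ n₀ : ℕ, ∀ n ≥ n₀, n ^ k ≤ 2 ^ ((Nat.log 2 n + c) ^ c) → ∃ (_ : NeZero (n ^ k)) (δ : ℕ) (lam : Nat.Partition (n ^ k * δ)), lam.parts.card ≤ n * n + 1 ∧ lam.parts.sup = δ * (n ^ k - n) ∧ kroneckerCoeff ℂ (rowLift lam (2 ^ ((Nat.log 2 n + c) ^ c) - n ^ k)) (Nat.Partition.rectangle (n ^ k + (2 ^ ((Nat.log 2 n + c) ^ c) - n ^ k)) δ) (Nat.Partition.rectangle (n ^ k + (2 ^ ((Nat.log 2 n + c) ^ c) - n ^ k)) δ) < orbitMultiplicity ℂ (paddedPerFormLex ℂ n (n ^ k)) (n ^ k) (partitionWeightLex (n ^ k) lam)) := by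
  constructor
  · rintro ⟨k, hk, hC⟩
    refine ⟨k, hk, fun c => ?_⟩
    obtain ⟨n₀, hn₀⟩ := hC c
    refine ⟨n₀, fun n hn hguard => ?_⟩
    obtain ⟨m₀, hm₀, δ, lam, hnm₀, hm₀k, hcard, hsup, hlt⟩ := hn₀ n hn hguard
    haveI := hm₀
    -- lift the datum from the base `m₀` to the base `n^k = m₀ + i`
    obtain ⟨i, hi⟩ : ∃ i, n ^ k = m₀ + i := ⟨n ^ k - m₀, by omega⟩
    haveI hki : NeZero (m₀ + i) := ⟨by have := NeZero.ne m₀; omega⟩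
    haveI hk' : NeZero (n ^ k) := ⟨by rw [hi]; exact NeZero.ne (m₀ + i)⟩
    have hlift := topBoundaryDatum_lift_base (T := 2 ^ ((Nat.log 2 n + c) ^ c)) hnm₀ i
      (by omega) lam hcard hsup hlt
    exact ⟨hk', topBoundaryDatum_congr_level (T := 2 ^ ((Nat.log 2 n + c) ^ c)) hi.symm
      ⟨δ, rowLift lam i, hlift⟩⟩
  · rintro ⟨k, hk, hC⟩
    refine ⟨k, hk, fun c => ?_⟩
    obtain ⟨n₀, hn₀⟩ := hC c
    refine ⟨max n₀ 2, fun n hn hguard => ?_⟩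
    have hn0 : n₀ ≤ n := (le_max_left _ _).trans hn
    have hn2 : 2 ≤ n := (le_max_right _ _).trans hn
    obtain ⟨hk', δ, lam, hcard, hsup, hlt⟩ := hn₀ n hn0 hguard
    have hnlt : n < n ^ k := by
      calc n = n ^ 1 := (pow_one n).symm
        _ < n ^ k := Nat.pow_lt_pow_right (by omega) (by omega)
    exact ⟨n ^ k, hk', δ, lam, hnlt, le_rfl, hcard, hsup, hlt⟩

end

end Summit.ValiantsHypothesis.ValiantsHypothesis.Theorems.TailFlip
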